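import Literature.AlgebraicGeometry.HodgeTheory.QuarticCMTwoOneSlotsHodgeClasses
import Literature.AlgebraicGeometry.HodgeTheory.RibetTypeOnePowersHodgeClasses
import Literature.AlgebraicGeometry.ComplexMultiplication.CMTypeOfSimpleSubvariety
import HarnessLib

/-!
# Hodge classes on all powers of a simple abelian fourfold whose endomorphism algebra is a quartic CM field acting with multiplicities `{(1,1), (2,0)}` are generated by divisor classes — unconditionally (Moonen–Zarhin 1999 Thm. (0.2)(4), simple Type IV(2,1); Moonen–Zarhin 1995)

Family `hodge`, layer `Literature/AlgebraicGeometry/HodgeTheory`. Research context: cell `pub-hodge-ring2`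
(HONEST FRAMING: research route conditional on HC_CM; not a corollary; Q11.4-sentence-2 already refuted in
dim ≥ 3), Literature lane, programme R10 «type IV(2,1) fourfolds», final (geometric) file. THEOREMS ONLY: no
definition, no named fact, no `sorry` (D-0026). It closes the atlas row «g = 4, Type IV(2,1), signature
{(1,1),(2,0)}, all powers» as a kernel theorem.

THE PRINTED THEOREM (Moonen–Zarhin 1999, Thm. (0.2)(4) [corpus: arXiv:math/9901113 p. 1], `dim X = 4` outside
the cases (a)–(d): "`Hg(X) = Sp_D(V,φ)` and `B(Xⁿ) = D(Xⁿ)` for all `n`"; (2.4) p. 5: the simple case is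
Moonen–Zarhin 1995, and "(2) … Weil classes … if `End⁰(X)` contains an imaginary quadratic field `k` which acts on
the tangent space with multiplicities `(2,2)` … it can occur only for `X` of Type IV(1,1) or of Type IV(4,1)").
HYPOTHESES HERE (the tree's vocabulary): `A` simple of dimension `4`, `finrank_ℚ End⁰(A) = 4`, `φ : A ⟶ A` whose
action `φ^*` on `H^{1,0}(A)` has the eigenvalue `μ₁` with multiplicity `1`, `conj μ₁` with multiplicity `1` and `μ₂`
with multiplicity `2` (`eigenMultiplicity`), the four numbers `μ₁, conj μ₁, μ₂, conj μ₂` pairwise distinct. Then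
`E = End⁰(A) = ℚ(φ)` is a quartic CM field (four distinct complex embeddings `φ ↦ μ`; a division ring of degree `4`)
acting with multiplicities `(n_σ) = (1, 1, 2, 0)`, i.e. signature `{(1,1),(2,0)}` — Type IV(2,1) outside case (b).

MAIN RESULTS.
* §1 `exists_eq_sum_smul_pow_bettiMapHom` (`End_Hdg(H¹(A;ℚ)) = ℚ[φ^*_ℚ]`: Vandermonde on eigenvectors of the four
  eigenvalues + `finrank_endAlg_hodge_one`), `exists_mul_eq_one_of_mem_endAlg_of_isSimple` (left inverses:
  Mumford §19 Cor. 2 + Riemann `mem_endAlg_hodge_one_iff_exists_bettiRep`), `finrank_bettiCohomology_one_of_dim_four`.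
* §2 `sum_cupH1_colour_mem_span_rational_oneOne` — **the crossed class `θ_k = ∑_ℓ e^k_ℓ ⌣ f^k_ℓ` of EACH colour is
  a rational `(1,1)`-class**, from the `ψ`-Casimir classes of `1, φ^*_ℚ, (φ^*_ℚ)²` (`= ∑_k (p(μ_k) + p(conj μ_k)) θ_k`)
  and the separation `μ₂ ∉ {μ₁, conj μ₁}`.
* §3 `AVSlots.isDivisorGenerated_of_quarticCM` — `B•(B) = D•(B) ⊗ ℂ` for every `B` with slots over `A`
  (`AVSlots.isDivisorGenerated_of_quarticData` fed with §§1–2 and `HodgeStructure.QuarticTheta.exists_adaptedDualBasis`);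
  `AbelianVariety.isDivisorGenerated_powSucc_of_quarticCM`, `AbelianVariety.isDivisorGenerated_of_quarticCM`,
  **`hodgeConjectureFor_powSucc_of_quarticCM`** (HC for all `A^{N+1}`), `hodgeConjectureFor_of_quarticCM`,
  `hodgeConjectureFor_of_isIsogenous_powSucc_of_quarticCM`.

## References

* [MoonenZarhin1999LowDim] B. Moonen, Yu. Zarhin, *Hodge classes on abelian varieties of low dimension*, Math.
  Ann. 315 (1999) = arXiv:math/9901113 (held `paper:arxiv-math_9901113`), Introduction (a)–(d), Thm. (0.2)(4),
  §2 (2.4) (p. 5), §3 (3.1).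
* [MoonenZarhin1995Duke] B. Moonen, Yu. Zarhin, *Hodge classes and Tate classes on simple abelian fourfolds*, Duke
  Math. J. 77 (1995) 553–581 (not held; the simple case of Thm. (0.2), via MZ99 (2.4)).
* [Milne1999LefschetzClasses] J. S. Milne, *Lefschetz classes on abelian varieties*, Duke Math. J. 96 (1999),
  Prop. 3.3, Prop. 3.6 (c).
* [MumfordAV1970] D. Mumford, *Abelian Varieties* (1970), §1 (p. 4), §19 Cor. 2 of Thm. 1 (p. 174).
* [DeligneMilne1982Tannakian] P. Deligne, J. S. Milne, *Tannakian categories*, LNM 900 (1982), §6 Thm. 6.20.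
* [Deligne1982HodgeCycles] P. Deligne, *Hodge cycles on abelian varieties*, LNM 900 (1982), §4 p. 30.
* [GoodmanWallachGTM255] R. Goodman, N. R. Wallach, GTM 255 (2009), §4.1.1.
* [vanGeemen1994HodgeAV] B. van Geemen, LNM 1594 (1994), Lemma 3.7.
-/

noncomputable section

open scoped TensorProduct Matrix
open CategoryTheory Module

namespace Literature.AlgebraicGeometry.HodgeTheory

open Literature.AlgebraicTopology.SingularHomology
open Literature.AlgebraicGeometry.Motives (IsSmoothProjective AbelianVariety bettiCohomology
  ofRatClassBaseChange ofRatClassBaseChange_tmul HodgeTensorFacts hodgeTensorFacts_holds)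
open Literature.Barriers.HodgeConjecture
open Literature.AlgebraicGeometry.Motives.HodgeStructure
open Literature.RepresentationTheory.GeneralLinear
open Literature.NumberTheory.DiophantineGeometry
open Literature.AlgebraicGeometry.ComplexMultiplication (bettiRep bettiRep_of endAlgebra_exists_inv_of_isSimple)

universe u

variable {A : AbelianVariety ℂ}

/-! ### §1 The rational pull-back `φ^*_ℚ` of a generator of a quartic CM field: `End_Hdg = ℚ[φ^*_ℚ]`, inverses, multiplicities -/

section Data

variable {V : Type u} [AddCommGroup V] [Module ℚ V]

/-- Rational scalars act on `V_ℂ` through `ℚ ⊆ ℂ`. [folklore] -/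
private theorem ratCast_smul' (q : ℚ) (z : ℂ ⊗[ℚ] V) : (q : ℂ) • z = q • z := by
  rw [← algebraMap_smul ℂ q z, eq_ratCast]

/-- `(Σ_k q_k φ^k)_ℂ w = (Σ_k q_k c^k) w` on `W_c = ker(φ_ℂ - c)` (`E ⊗ ℂ` acts on `H¹_σ` through `σ`).
[cite: Deligne1982HodgeCycles, §4 (p. 30)] -/
theorem baseChange_sum_smul_pow_apply (φ : Module.End ℚ V) (q : Fin 4 → ℚ) {c : ℂ} {w : ℂ ⊗[ℚ] V}
    (hw : w ∈ Module.End.eigenspace (φ.baseChange ℂ) c) :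
    (∑ k, q k • φ ^ (k : ℕ)).baseChange ℂ w = (∑ k, (q k : ℂ) * c ^ (k : ℕ)) • w := by
  have h : ∀ s : Finset (Fin 4), (∑ k ∈ s, q k • φ ^ (k : ℕ)).baseChange ℂ w =
      (∑ k ∈ s, (q k : ℂ) * c ^ (k : ℕ)) • w := by
    intro s
    induction s using Finset.induction_on with
    | empty => rw [Finset.sum_empty, Finset.sum_empty, LinearMap.baseChange_zero, LinearMap.zero_apply, zero_smul]
    | insert k s hk ih =>
      rw [Finset.sum_insert hk, Finset.sum_insert hk, LinearMap.baseChange_add, LinearMap.add_apply, ih,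
        LinearMap.baseChange_smul, LinearMap.smul_apply, QuarticTheta.baseChange_pow_apply φ hw,
        ← ratCast_smul', smul_smul, add_smul]
  exact h Finset.univ

end Data

/-- **`dim_ℚ H¹(A(ℂ); ℚ) = 8` for a fourfold.** [cite: MumfordAV1970, §1 (p. 4)] -/
theorem finrank_bettiCohomology_one_of_dim_four (hdim : A.dim = 4) :
    Module.finrank ℚ (bettiCohomology A.X 1) = 8 := by
  rw [finrank_bettiCohomology_one A, hdim]

/-- **`End_Hdg(H¹(A; ℚ)) = ℚ + ℚφ^*_ℚ + ℚ(φ^*_ℚ)² + ℚ(φ^*_ℚ)³` when `finrank_ℚ End⁰(A) = 4` and `φ^*_ℂ` has four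
distinct eigenvalues with non-zero eigenspaces**: `1, φ^*_ℚ, (φ^*_ℚ)², (φ^*_ℚ)³` are linearly independent (a
vanishing rational combination kills an eigenvector for each of the four eigenvalues: a Vandermonde system), in
the `4`-dimensional `End_Hdg(H¹) ≅ End⁰(A)ᵒᵖ` (`finrank_endAlg_hodge_one`). MZ99 §2: Type IV(`e₀`, `d²`) with
`End⁰(X) = E` a CM field of degree `2e₀ = 4`. [cite: MoonenZarhin1999LowDim, §2 (2.4) and §1]
[cite: Deligne1982HodgeCycles, §4 (p. 30)] -/
theorem exists_eq_sum_smul_pow_bettiMapHom (hHD : exists_isReal_hodgeModel)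
    (hI : hodgePQ_independent_of_hodgeModel) (φ : A ⟶ A) (hE4 : Module.finrank ℚ A.endAlgebra = 4)
    (c : Fin 4 → ℂ) (hc : Function.Injective c)
    (hW : ∀ j, Module.End.eigenspace ((bettiCohomology.map φ.hom.hom.hom 1).hom.baseChange ℂ) (c j) ≠ ⊥) :
    ∀ a ∈ (BettiUniverse.hodge hHD (AbelianVariety.isSmoothProjective_holds (A := A)) 1).endAlg,
      ∃ q : Fin 4 → ℚ, a = ∑ k, q k • (bettiCohomology.map φ.hom.hom.hom 1).hom ^ (k : ℕ) := by
  classical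
  intro a ha
  haveI : Module.Finite ℚ (bettiCohomology A.X 1) := finite_bettiCohomology_one A
  set φQ : Module.End ℚ (bettiCohomology A.X 1) := (bettiCohomology.map φ.hom.hom.hom 1).hom with hφQ
  have hφE : φQ ∈ (BettiUniverse.hodge hHD (AbelianVariety.isSmoothProjective_holds (A := A)) 1).endAlg := by
    have h := unop_bettiRep_mem_endAlg hHD hI (AbelianVariety.endAlgebra.of A φ)
    rwa [bettiRep_of, MulOpposite.unop_op] at h
  -- `1, φQ, φQ², φQ³` linearly independent
  have hli : LinearIndependent ℚ (fun k : Fin 4 => φQ ^ (k : ℕ)) := by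
    rw [Fintype.linearIndependent_iff]
    intro q hq
    -- evaluate on an eigenvector for each eigenvalue
    have hvan : ∀ j, ∑ k, (q k : ℂ) * c j ^ (k : ℕ) = 0 := by
      intro j
      obtain ⟨w, hw, hw0⟩ := (Submodule.ne_bot_iff _).1 (hW j)
      have h := baseChange_sum_smul_pow_apply φQ q hw
      rw [hq, LinearMap.baseChange_zero, LinearMap.zero_apply] at h
      exact (smul_eq_zero.1 h.symm).resolve_right hw0
    have hmul : (Matrix.vandermonde c).mulVec (fun k => (q k : ℂ)) = 0 := by
      funext j
      rw [Matrix.mulVec, Pi.zero_apply]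
      change ∑ k, Matrix.vandermonde c j k * (q k : ℂ) = 0
      simp only [Matrix.vandermonde_apply]
      rw [← hvan j]
      exact Finset.sum_congr rfl fun k _ => mul_comm _ _
    have hdet : (Matrix.vandermonde c).det ≠ 0 := Matrix.det_vandermonde_ne_zero_iff.2 hc
    have h0 := Matrix.eq_zero_of_mulVec_eq_zero hdet hmul
    intro k
    have hk := congrFun h0 k
    rw [Pi.zero_apply, Rat.cast_eq_zero] at hk
    exact hk
  -- `span = End_Hdg` by dimension
  set P := Submodule.span ℚ (Set.range fun k : Fin 4 => φQ ^ (k : ℕ)) with hP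
  have hPle : P ≤ Subalgebra.toSubmodule
      (BettiUniverse.hodge hHD (AbelianVariety.isSmoothProjective_holds (A := A)) 1).endAlg := by
    refine Submodule.span_le.2 ?_
    rintro _ ⟨k, rfl⟩
    exact Subalgebra.pow_mem _ hφE _
  have hPrank : Module.finrank ℚ P = 4 := by
    rw [hP, finrank_span_eq_card hli, Fintype.card_fin]
  have hErank : Module.finrank ℚ (Subalgebra.toSubmodule
      (BettiUniverse.hodge hHD (AbelianVariety.isSmoothProjective_holds (A := A)) 1).endAlg) = 4 := by
    rw [Subalgebra.finrank_toSubmodule, finrank_endAlg_hodge_one hHD hI, hE4]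
  have hPeq := Submodule.eq_of_le_of_finrank_le hPle (by rw [hPrank, hErank])
  have haP : a ∈ P := by
    rw [hPeq, Subalgebra.mem_toSubmodule]
    exact ha
  rw [hP, Submodule.mem_span_range_iff_exists_fun] at haP
  obtain ⟨cf, hcf⟩ := haP
  exact ⟨cf, hcf.symm⟩

/-- **Every non-zero Hodge endomorphism of `H¹(A; ℚ)` has a left inverse when `A` is simple** (`End⁰(A)` is a
division ring, Mumford §19 Cor. 2 of Thm. 1, and `End_Hdg(H¹) = (End⁰(A)^*)` by Riemann,
`mem_endAlg_hodge_one_iff_exists_bettiRep`). [cite: MumfordAV1970, §19 Cor. 2 of Thm. 1 (p. 174)]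
[cite: DeligneMilne1982Tannakian, §6 Thm. 6.20] -/
theorem exists_mul_eq_one_of_mem_endAlg_of_isSimple (hHD : exists_isReal_hodgeModel)
    (hI : hodgePQ_independent_of_hodgeModel) (hA : A.IsSimple) :
    ∀ a ∈ (BettiUniverse.hodge hHD (AbelianVariety.isSmoothProjective_holds (A := A)) 1).endAlg,
      a ≠ 0 → ∃ b : Module.End ℚ (bettiCohomology A.X 1), b * a = 1 := by
  intro a ha ha0
  obtain ⟨e, rfl⟩ := (mem_endAlg_hodge_one_iff_exists_bettiRep hHD hI a).1 ha
  have he0 : e ≠ 0 := fun h => ha0 (by rw [h, map_zero, MulOpposite.unop_zero])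
  obtain ⟨y, hey, -⟩ := endAlgebra_exists_inv_of_isSimple hA e he0
  refine ⟨MulOpposite.unop (bettiRep A y), ?_⟩
  rw [← MulOpposite.unop_mul, ← map_mul, hey, map_one, MulOpposite.unop_one]

/-! ### §2 The crossed classes of each colour: `θ_k = ∑_ℓ e^k_ℓ ⌣ f^k_ℓ ∈ B¹(A) ⊗ ℂ` from the `ψ`-Casimir classes of `1, φ, φ²` -/

/-- **`θ_k = ∑_ℓ ρ(cb((k,0),ℓ)) ⌣ ρ(cb((k,1),ℓ)) ∈ B¹(A) ⊗ ℂ` for each colour `k`**, for adapted `ψ_ℂ`-dual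
bases `cb` of `H¹ ⊗ ℂ = ⊕_c W_c` (pairing table `δ_{kk'}δ_{ij}` across types, `0` on equal types) with
`φ_ℂ = μ k` on `cb((k,0),·)` and `conj μ k` on `cb((k,1),·)`, `φ` RATIONAL. The `ψ_ℂ`-dual family of `cb` is
`((k,0),ℓ) ↦ -cb((k,1),ℓ)`, `((k,1),ℓ) ↦ cb((k,0),ℓ)`, so the `ψ`-Casimir class `Λ(T)` of an operator acting
on `cb((k,t),·)` by scalars `s(k,t)`, computed in a rational basis (`sum_dual_eq_sum_dual`), is
`∑_k (s(k,0) + s(k,1)) θ_k`; for `T = 1, φ_ℂ, φ_ℂ²` these are RATIONAL `(1,1)`-classes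
(`isRationalClass_casimirClass_baseChange`) with coefficient vectors `(2, 2)`, `(μ_k + conj μ_k)_k`,
`(μ_k² + conj μ_k²)_k`; since `μ 1 ∉ {μ 0, conj μ 0}`, the first vector and one of the other two are
independent, and `θ_0, θ_1` are recovered. (Milne Prop. 3.3: the pairing class of each `W_σ ⊗ W_σ^∨` is a
divisor class; Goodman–Wallach §4.1.1: the Casimir element is independent of the dual bases.)
[cite: Milne1999LefschetzClasses, Prop. 3.3 (p. 652)] [cite: GoodmanWallachGTM255, §4.1.1]
[cite: MoonenZarhin1999LowDim, Thm. (0.2)(4)] -/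
theorem sum_cupH1_colour_mem_span_rational_oneOne [HodgeTensorFacts.{0, 0}]
    (hHD : exists_isReal_hodgeModel) (hI : hodgePQ_independent_of_hodgeModel)
    (ψ : (BettiUniverse.hodge hHD (AbelianVariety.isSmoothProjective_holds (A := A)) 1).Polarization)
    (φ : Module.End ℚ (bettiCohomology A.X 1)) (μ : Fin 2 → ℂ) (h12 : μ 1 ≠ μ 0)
    (h12' : μ 1 ≠ starRingEnd ℂ (μ 0))
    {n₀ : ℕ} (cb : Module.Basis ((Fin 2 × Fin 2) × Fin n₀) ℂ (ℂ ⊗[ℚ] bettiCohomology A.X 1))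
    (κ : Fin 2 × Fin n₀ → Fin 2)
    (hcbW : ∀ k ℓ, cb ((k, 0), ℓ) ∈ Module.End.eigenspace (φ.baseChange ℂ) (μ k))
    (hcbW' : ∀ k ℓ, cb ((k, 1), ℓ) ∈ Module.End.eigenspace (φ.baseChange ℂ) (starRingEnd ℂ (μ k)))
    (hcb0 : ∀ k ℓ, κ (k, ℓ) = 0 →
      cb ((k, 0), ℓ) ∈ (BettiUniverse.hodge hHD (AbelianVariety.isSmoothProjective_holds (A := A)) 1).piece 1 0 ∧
      cb ((k, 1), ℓ) ∈ (BettiUniverse.hodge hHD (AbelianVariety.isSmoothProjective_holds (A := A)) 1).piece 0 1)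
    (hcb1 : ∀ k ℓ, κ (k, ℓ) = 1 →
      cb ((k, 0), ℓ) ∈ (BettiUniverse.hodge hHD (AbelianVariety.isSmoothProjective_holds (A := A)) 1).piece 0 1 ∧
      cb ((k, 1), ℓ) ∈ (BettiUniverse.hodge hHD (AbelianVariety.isSmoothProjective_holds (A := A)) 1).piece 1 0)
    (hdual : ∀ k k' i j, ψ.form.baseChange ℂ (cb ((k, 0), i)) (cb ((k', 1), j)) =
      if k = k' ∧ i = j then 1 else 0)
    (hiso : ∀ k k' (t : Fin 2) i j, ψ.form.baseChange ℂ (cb ((k, t), i)) (cb ((k', t), j)) = 0) (k : Fin 2) :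
    (∑ ℓ, cupH1 A (cb ((k, 0), ℓ)) (cb ((k, 1), ℓ))) ∈
      Submodule.span ℂ {c : complexBetti A.X 2 | IsRationalClass c ∧ IsOfHodgeType A.dim A.X 2 1 1 c} := by
  classical
  have hX : IsSmoothProjective A.dim A.X := AbelianVariety.isSmoothProjective_holds
  haveI : Module.Finite ℚ (bettiCohomology A.X 1) := finite_bettiCohomology_one A
  set S := Submodule.span ℂ
    {c : complexBetti A.X 2 | IsRationalClass c ∧ IsOfHodgeType A.dim A.X 2 1 1 c} with hS
  set Ψ := ψ.form.baseChange ℂ with hΨ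
  have hswap : ∀ x y, Ψ y x = -Ψ x y := fun x y => by
    rw [hΨ, ψ.form_baseChange_swap, show (((1 : ℕ) : ℤ)).negOnePow = -1 from Int.negOnePow_one]
    simp
  have h2 : ∀ r : Fin 2, r = 0 ∨ r = 1 := fun r => by fin_cases r <;> simp
  -- the `ψ_ℂ`-dual family `d'` of `cb`
  set d' : (Fin 2 × Fin 2) × Fin n₀ → ℂ ⊗[ℚ] bettiCohomology A.X 1 :=
    fun x => if x.1.2 = 0 then -cb ((x.1.1, 1), x.2) else cb ((x.1.1, 0), x.2) with hd'
  have hd'0 : ∀ k' i, d' ((k', 0), i) = -cb ((k', 1), i) := fun k' i => by simp [hd']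
  have hd'1 : ∀ k' i, d' ((k', 1), i) = cb ((k', 0), i) := fun k' i => by simp [hd']
  have hdual' : ∀ x y, Ψ (d' x) (cb y) = if y = x then 1 else 0 := by
    rintro ⟨⟨k₁, t₁⟩, i⟩ ⟨⟨k₂, t₂⟩, j⟩
    rcases h2 t₁ with rfl | rfl <;> rcases h2 t₂ with rfl | rfl
    · rw [hd'0, map_neg, LinearMap.neg_apply, hswap, neg_neg, hΨ, hdual]
      by_cases h : k₂ = k₁ ∧ j = i
      · rw [if_pos h, if_pos (by rw [h.1, h.2])]
      · rw [if_neg h, if_neg (fun h' => h (by simp only [Prod.mk.injEq] at h'; exact ⟨h'.1.1, h'.2⟩))]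
    · rw [hd'0, map_neg, LinearMap.neg_apply, hΨ, hiso, neg_zero, if_neg (fun h' => ?_)]
      simp only [Prod.mk.injEq] at h'
      exact absurd h'.1.2 (by decide)
    · rw [hd'1, hΨ, hiso, if_neg (fun h' => ?_)]
      simp only [Prod.mk.injEq] at h'
      exact absurd h'.1.2 (by decide)
    · rw [hd'1, hΨ, hdual]
      by_cases h : k₁ = k₂ ∧ i = j
      · rw [if_pos h, if_pos (by rw [h.1, h.2])]
      · rw [if_neg h, if_neg (fun h' => h (by simp only [Prod.mk.injEq] at h'; exact ⟨h'.1.1.symm, h'.2.symm⟩))]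
  have hsep : ∀ y, (∀ x, Ψ (d' x) y = 0) → y = 0 := by
    intro y hy
    have hb : ∀ x : (Fin 2 × Fin 2) × Fin n₀, Ψ (cb x) y = 0 := by
      rintro ⟨⟨k', t⟩, i⟩
      rcases h2 t with rfl | rfl
      · have h1 := hy ((k', 1), i)
        rwa [hd'1] at h1
      · have h0 := hy ((k', 0), i)
        rwa [hd'0, map_neg, LinearMap.neg_apply, neg_eq_zero] at h0
    refine ψ.eq_zero_of_forall_form_eq_zero' fun x => ?_
    rw [← cb.sum_repr x, map_sum, LinearMap.sum_apply]
    exact Finset.sum_eq_zero fun tk _ => by rw [map_smul, LinearMap.smul_apply, ← hΨ, hb, smul_zero]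
  -- the crossed classes `θ k'` and graded commutativity
  set θ : Fin 2 → complexBetti A.X 2 := fun k' => ∑ ℓ, cupH1 A (cb ((k', 0), ℓ)) (cb ((k', 1), ℓ)) with hθ
  have hgc : ∀ k' ℓ, cupH1 A (cb ((k', 1), ℓ)) (cb ((k', 0), ℓ)) = -cupH1 A (cb ((k', 0), ℓ)) (cb ((k', 1), ℓ)) :=
    fun k' ℓ => by
      rw [cupH1_apply, cupH1_apply, cupProduct_gradedComm_holds ℂ (Motives.ComplexPoints A.X)
        (rfl : 1 + 1 = 2) (rfl : 1 + 1 = 2)]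
      norm_num
  -- the Casimir class of an operator acting by scalars on the adapted basis
  set eQ := Module.finBasis ℚ (bettiCohomology A.X 1) with heQ
  have hcas : ∀ (T : Module.End ℂ (ℂ ⊗[ℚ] bettiCohomology A.X 1)) (s : Fin 2 × Fin 2 → ℂ),
      (∀ (kt : Fin 2 × Fin 2) ℓ, T (cb (kt, ℓ)) = s kt • cb (kt, ℓ)) →
      casimirClass A ψ.form ψ.nondegenerate eQ T = ∑ k', (s (k', 0) + s (k', 1)) • θ k' := by
    intro T s hT
    rw [casimirClass_apply, sum_dual_eq_sum_dual Ψ (cupH1 A) _ _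
      (eq_sum_formBaseChange_smul_dualBasis ψ.form ψ.nondegenerate eQ) (⇑cb) d' hdual' hsep T,
      Fintype.sum_prod_type, Fintype.sum_prod_type]
    refine Finset.sum_congr rfl fun k' _ => ?_
    rw [Fin.sum_univ_two, hθ]
    simp only [hd'0, hd'1, map_neg, hT, map_smul, LinearMap.neg_apply, LinearMap.smul_apply, hgc,
      Finset.smul_sum, ← Finset.sum_add_distrib, add_smul]
    exact Finset.sum_congr rfl fun ℓ _ => by module
  -- Hodge type `(1,1)` of each `θ k'`
  have hcup := BettiUniverse.cupPreservesHodgeType hHD hI hX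
  obtain ⟨M⟩ := nonempty_hodgeModel_holds hX
  have htype : ∀ k', IsOfHodgeType A.dim A.X 2 1 1 (θ k') := by
    intro k'
    refine IsOfHodgeType.sum hX M _ _ fun ℓ _ => ?_
    rw [cupH1_apply]
    rcases h2 (κ (k', ℓ)) with h | h
    · have h10 := (BettiUniverse.mem_hodge_piece_iff hHD hI hX (k := 1) (p := 1) (q := 0) rfl _).1 (hcb0 k' ℓ h).1
      have h01 := (BettiUniverse.mem_hodge_piece_iff hHD hI hX (k := 1) (p := 0) (q := 1) rfl _).1 (hcb0 k' ℓ h).2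
      have h' : IsOfHodgeType A.dim A.X 2 (1 + 0) (0 + 1) _ := hcup (rfl : 1 + 1 = 2) h10 h01
      exact h'
    · have h01 := (BettiUniverse.mem_hodge_piece_iff hHD hI hX (k := 1) (p := 0) (q := 1) rfl _).1 (hcb1 k' ℓ h).1
      have h10 := (BettiUniverse.mem_hodge_piece_iff hHD hI hX (k := 1) (p := 1) (q := 0) rfl _).1 (hcb1 k' ℓ h).2
      have h' : IsOfHodgeType A.dim A.X 2 (0 + 1) (1 + 0) _ := hcup (rfl : 1 + 1 = 2) h01 h10
      exact h'
  -- the rational `(1,1)`-classes `Λ(a_ℂ) = Σ_k (p_a(μ k) + p_a(conj μ k)) θ_k` for `a = 1, φ, φ²`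
  have hmemS : ∀ (a : Module.End ℚ (bettiCohomology A.X 1)) (s : Fin 2 × Fin 2 → ℂ),
      (∀ (kt : Fin 2 × Fin 2) ℓ, a.baseChange ℂ (cb (kt, ℓ)) = s kt • cb (kt, ℓ)) →
      (∑ k', (s (k', 0) + s (k', 1)) • θ k') ∈ S := by
    intro a s ha
    rw [← hcas _ s ha]
    refine Submodule.subset_span ⟨isRationalClass_casimirClass_baseChange ψ.form ψ.nondegenerate eQ a, ?_⟩
    rw [hcas _ s ha]
    exact IsOfHodgeType.sum hX M _ _ fun k' _ => (htype k').smul _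
  have hφcb : ∀ (kt : Fin 2 × Fin 2) ℓ, φ.baseChange ℂ (cb (kt, ℓ)) =
      (if kt.2 = 0 then μ kt.1 else starRingEnd ℂ (μ kt.1)) • cb (kt, ℓ) := by
    rintro ⟨k', t⟩ ℓ
    rcases h2 t with rfl | rfl
    · rw [if_pos rfl]; exact Module.End.mem_eigenspace_iff.1 (hcbW k' ℓ)
    · rw [if_neg one_ne_zero]; exact Module.End.mem_eigenspace_iff.1 (hcbW' k' ℓ)
  have hR1 : (∑ k', ((1 : ℂ) + 1) • θ k') ∈ S :=
    hmemS 1 (fun _ => 1) fun kt ℓ => by rw [LinearMap.baseChange_one, Module.End.one_apply, one_smul]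
  have hRφ : (∑ k', (μ k' + starRingEnd ℂ (μ k')) • θ k') ∈ S := by
    have h := hmemS φ (fun kt => if kt.2 = 0 then μ kt.1 else starRingEnd ℂ (μ kt.1)) hφcb
    simpa using h
  have hRφ2 : (∑ k', (μ k' ^ 2 + starRingEnd ℂ (μ k') ^ 2) • θ k') ∈ S := by
    have h := hmemS (φ * φ) (fun kt => (if kt.2 = 0 then μ kt.1 else starRingEnd ℂ (μ kt.1)) ^ 2) fun kt ℓ => by
      rw [LinearMap.baseChange_mul, Module.End.mul_apply, hφcb, map_smul, hφcb, smul_smul, sq]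
    simpa using h
  -- separation of the two colours
  have hsepar : ∀ γ : Fin 2 → ℂ, γ 0 ≠ γ 1 → (∑ k', γ k' • θ k') ∈ S → ∀ k', θ k' ∈ S := by
    intro γ hγ hR k'
    rw [Fin.sum_univ_two] at hR
    have hR1' : ((1 : ℂ) + 1) • θ 0 + ((1 : ℂ) + 1) • θ 1 ∈ S := by rw [Fin.sum_univ_two] at hR1; exact hR1
    rcases h2 k' with rfl | rfl
    · have h : (γ 0 - γ 1) • θ 0 = (γ 0 • θ 0 + γ 1 • θ 1) - (γ 1 / 2) • (((1 : ℂ) + 1) • θ 0 + ((1 : ℂ) + 1) • θ 1) := by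
        module
      rw [← one_smul ℂ (θ 0), ← inv_mul_cancel₀ (sub_ne_zero.2 hγ), ← smul_smul, h]
      exact S.smul_mem _ (S.sub_mem hR (S.smul_mem _ hR1'))
    · have h : (γ 1 - γ 0) • θ 1 = (γ 0 • θ 0 + γ 1 • θ 1) - (γ 0 / 2) • (((1 : ℂ) + 1) • θ 0 + ((1 : ℂ) + 1) • θ 1) := by
        module
      rw [← one_smul ℂ (θ 1), ← inv_mul_cancel₀ (sub_ne_zero.2 (Ne.symm hγ)), ← smul_smul, h]
      exact S.smul_mem _ (S.sub_mem hR (S.smul_mem _ hR1'))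
  by_cases hs : μ 0 + starRingEnd ℂ (μ 0) = μ 1 + starRingEnd ℂ (μ 1)
  · -- equal traces: the sums of squares differ
    refine hsepar (fun k' => μ k' ^ 2 + starRingEnd ℂ (μ k') ^ 2) (fun hs' => ?_) hRφ2 k
    have hroot : (μ 1 - μ 0) * (μ 1 - starRingEnd ℂ (μ 0)) = 0 := by
      linear_combination (-μ 1 + (μ 0 + starRingEnd ℂ (μ 0) + μ 1 + starRingEnd ℂ (μ 1)) / 2) * hs
        - (1 / 2 : ℂ) * hs'
    rcases mul_eq_zero.1 hroot with h | h
    · exact h12 (sub_eq_zero.1 h)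
    · exact h12' (sub_eq_zero.1 h)
  · exact hsepar (fun k' => μ k' + starRingEnd ℂ (μ k')) hs hRφ k

/-! ### §3 The unconditional assembly on a simple abelian fourfold with quartic CM of signature `{(1,1),(2,0)}` -/

section Assembly

variable {B : AbelianVariety ℂ} {n : ℕ} {g : Fin n → (B ⟶ A)}

/-- **`B•(B) = D•(B) ⊗ ℂ` for every abelian variety `B` with slots over a simple abelian FOURFOLD `A` with
`finrank_ℚ End⁰(A) = 4` and an endomorphism `φ` whose action on `H^{1,0}(A)` has eigenvalues `μ₁` (multiplicity
`1`), `conj μ₁` (multiplicity `1`) and `μ₂` (multiplicity `2`), `μ₁, conj μ₁, μ₂, conj μ₂` pairwise distinct —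
UNCONDITIONAL.** Then `End⁰(A) = ℚ(φ)` is a quartic CM field acting with multiplicities `{(1,1),(2,0)}`
(Moonen–Zarhin's simple Type IV(2,1) outside case (b)), and the theorem is assembled from
`AVSlots.isDivisorGenerated_of_quarticData` with the data of §§1–2: `End_Hdg(H¹) = ℚ[φ^*_ℚ]`
(`exists_eq_sum_smul_pow_bettiMapHom`), left inverses (`exists_mul_eq_one_of_mem_endAlg_of_isSimple`), the
multiplicities (`finrank_eigenspace_inf_piece_oneZero_eq_eigenMultiplicity`, `…_zeroOne_eq_eigenMultiplicity_conj`),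
adapted dual bases (`HodgeStructure.QuarticTheta.exists_adaptedDualBasis`), and the crossed classes
(`sum_cupH1_colour_mem_span_rational_oneOne` with `Milne1999.sum_cross_mem_span_rational_oneOne_of_eigen`).
MZ99 (0.2)(4): "`Hg(X) = Sp_D(V,φ)` and `B(Xⁿ) = D(Xⁿ)` for all `n`".
[cite: MoonenZarhin1999LowDim, Thm. (0.2)(4) and §2 (2.4)] [cite: MoonenZarhin1995Duke, Thm. (0.2) for simple fourfolds (via MZ99 (2.4))]
[cite: Milne1999LefschetzClasses, Prop. 3.3 and Prop. 3.6 (c)] -/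
theorem AVSlots.isDivisorGenerated_of_quarticCM (hg : AVSlots A B g) (hA : A.IsSimple) (φ : A ⟶ A)
    (hE4 : Module.finrank ℚ A.endAlgebra = 4) {μ₁ μ₂ : ℂ} (h11 : starRingEnd ℂ μ₁ ≠ μ₁)
    (h22 : starRingEnd ℂ μ₂ ≠ μ₂) (h12 : μ₂ ≠ μ₁) (h12' : μ₂ ≠ starRingEnd ℂ μ₁)
    (h1 : eigenMultiplicity A φ μ₁ = 1) (h1' : eigenMultiplicity A φ (starRingEnd ℂ μ₁) = 1)
    (h2 : eigenMultiplicity A φ μ₂ = 2) (hdim : A.dim = 4) : IsDivisorGenerated B := by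
  classical
  have hHD : exists_isReal_hodgeModel := exists_isReal_hodgeModel_holds
  have hI : hodgePQ_independent_of_hodgeModel := hodgePQ_independent_of_hodgeModel_holds
  haveI : HodgeTensorFacts.{0, 0} := hodgeTensorFacts_holds.{0, 0}
  haveI : Module.Finite ℚ (bettiCohomology A.X 1) := finite_bettiCohomology_one A
  have hX : IsSmoothProjective A.dim A.X := AbelianVariety.isSmoothProjective_holds
  -- a polarization of `H¹(A(ℂ); ℚ)`
  obtain ⟨ψ⟩ : (BettiUniverse.hodge hHD (AbelianVariety.isSmoothProjective_holds (A := A)) 1).IsPolarizable :=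
    smoothProjective_hodgeStructure_isPolarizable_holds hX (BettiUniverse.realHodgeModel hHD hX)
      (BettiUniverse.realHodgeModel_isHodgeSymmetric hHD hX) 1
  have heff := BettiUniverse.hodge_isEffective hHD hX 1
  -- the rational datum `φ^*_ℚ`
  set φQ : Module.End ℚ (bettiCohomology A.X 1) := (bettiCohomology.map φ.hom.hom.hom 1).hom with hφQ
  have hφE : φQ ∈ (BettiUniverse.hodge hHD (AbelianVariety.isSmoothProjective_holds (A := A)) 1).endAlg := by
    have h := unop_bettiRep_mem_endAlg hHD hI (AbelianVariety.endAlgebra.of A φ)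
    rwa [bettiRep_of, MulOpposite.unop_op] at h
  have hV : Module.finrank ℚ (bettiCohomology A.X 1) = 8 := finrank_bettiCohomology_one_of_dim_four hdim
  -- multiplicities
  set μ : Fin 2 → ℂ := ![μ₁, μ₂] with hμ
  have hμ0 : μ 0 = μ₁ := rfl
  have hμ1 : μ 1 = μ₂ := rfl
  have h1a : Module.finrank ℂ ↥(Module.End.eigenspace (φQ.baseChange ℂ) (μ 0) ⊓
      (BettiUniverse.hodge hHD (AbelianVariety.isSmoothProjective_holds (A := A)) 1).piece 1 0) = 1 := by
    rw [hμ0, hφQ, finrank_eigenspace_inf_piece_oneZero_eq_eigenMultiplicity hHD hI φ μ₁, h1]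
  have h1b : Module.finrank ℂ ↥(Module.End.eigenspace (φQ.baseChange ℂ) (μ 0) ⊓
      (BettiUniverse.hodge hHD (AbelianVariety.isSmoothProjective_holds (A := A)) 1).piece 0 1) = 1 := by
    rw [hμ0, hφQ, finrank_eigenspace_inf_piece_zeroOne_eq_eigenMultiplicity_conj hHD hI φ μ₁, h1']
  have h2a : Module.finrank ℂ ↥(Module.End.eigenspace (φQ.baseChange ℂ) (μ 1) ⊓
      (BettiUniverse.hodge hHD (AbelianVariety.isSmoothProjective_holds (A := A)) 1).piece 1 0) = 2 := by
    rw [hμ1, hφQ, finrank_eigenspace_inf_piece_oneZero_eq_eigenMultiplicity hHD hI φ μ₂, h2]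
  have h2b : Module.finrank ℂ ↥(Module.End.eigenspace (φQ.baseChange ℂ) (starRingEnd ℂ μ₂) ⊓
      (BettiUniverse.hodge hHD (AbelianVariety.isSmoothProjective_holds (A := A)) 1).piece 0 1) = 2 := by
    rw [hφQ, finrank_eigenspace_inf_piece_zeroOne_eq_eigenMultiplicity_conj hHD hI φ, starRingEnd_self_apply, h2]
  have h1c : Module.finrank ℂ ↥(Module.End.eigenspace (φQ.baseChange ℂ) (starRingEnd ℂ μ₁) ⊓
      (BettiUniverse.hodge hHD (AbelianVariety.isSmoothProjective_holds (A := A)) 1).piece 1 0) = 1 := by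
    rw [hφQ, finrank_eigenspace_inf_piece_oneZero_eq_eigenMultiplicity hHD hI φ, h1']
  -- `End_Hdg = ℚ[φQ]` (the four eigenspaces are non-zero) and left inverses
  have hne : ∀ (S T : Submodule ℂ (ℂ ⊗[ℚ] bettiCohomology A.X 1)) (m : ℕ),
      Module.finrank ℂ ↥(S ⊓ T) = m → m ≠ 0 → S ≠ ⊥ := by
    intro S T m hm hm0 hS
    apply hm0
    rw [← hm, hS, bot_inf_eq, finrank_bot]
  set c : Fin 4 → ℂ := ![μ₁, starRingEnd ℂ μ₁, μ₂, starRingEnd ℂ μ₂] with hc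
  have h21 : starRingEnd ℂ μ₂ ≠ μ₁ := fun h => h12' (by rw [← h, starRingEnd_self_apply])
  have hcinj : Function.Injective c := by
    intro i j hij
    fin_cases i <;> fin_cases j
    all_goals simp [hc] at hij
    all_goals first
      | rfl
      | exact absurd hij h11.symm | exact absurd hij h11 | exact absurd hij h12.symm | exact absurd hij h12
      | exact absurd hij h21.symm | exact absurd hij h21
      | exact absurd hij (fun h => h12' (by rw [← h, starRingEnd_self_apply]))
      | exact absurd hij (fun h => h12' (by rw [h, starRingEnd_self_apply]))
      | exact absurd hij (fun h => h12 (RingHom.injective _ h))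
      | exact absurd hij (fun h => h12 (RingHom.injective _ h).symm)
      | exact absurd hij h12' | exact absurd hij h12'.symm
      | exact absurd hij h22 | exact absurd hij h22.symm
  have hW : ∀ j, Module.End.eigenspace (φQ.baseChange ℂ) (c j) ≠ ⊥ := by
    intro j
    fin_cases j
    · exact hne _ _ 1 (hμ0 ▸ h1a) one_ne_zero
    · exact hne _ _ 1 h1c one_ne_zero
    · exact hne _ _ 2 (hμ1 ▸ h2a) two_ne_zero
    · exact hne _ _ 2 h2b two_ne_zero
  have hE := exists_eq_sum_smul_pow_bettiMapHom hHD hI φ hE4 c hcinj hW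
  have hdiv := exists_mul_eq_one_of_mem_endAlg_of_isSimple hHD hI hA
  have h11' : starRingEnd ℂ (μ 0) ≠ μ 0 := by rw [hμ0]; exact h11
  have h22' : starRingEnd ℂ (μ 1) ≠ μ 1 := by rw [hμ1]; exact h22
  have h12μ : μ 1 ≠ μ 0 := by rw [hμ0, hμ1]; exact h12
  have h12μ' : μ 1 ≠ starRingEnd ℂ (μ 0) := by rw [hμ0, hμ1]; exact h12'
  -- adapted dual bases
  obtain ⟨cb, κ, hcbW, hcbW', hcb0, hcb1, hdual, hiso⟩ := QuarticTheta.exists_adaptedDualBasis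
    (BettiUniverse.hodge hHD (AbelianVariety.isSmoothProjective_holds (A := A)) 1) Nat.cast_one heff ψ hφE hE
    μ h11' h22' h12μ h12μ' hV h1a h1b h2a
  refine hg.isDivisorGenerated_of_quarticData hHD hI ψ hφE hE hdiv μ h11' h22' h12μ h12μ' hV h1a h1b h2a cb κ
    hcbW hcbW' hcb0 hcb1 hdual hiso fun j j' k => ?_
  -- the crossed classes are divisor classes
  have hθ := sum_cupH1_colour_mem_span_rational_oneOne hHD hI ψ φQ μ h12μ h12μ' cb κ hcbW hcbW' hcb0 hcb1
    hdual hiso k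
  simp only [cupH1_apply] at hθ
  have hneμ : μ k ≠ starRingEnd ℂ (μ k) := by
    rcases (show k = 0 ∨ k = 1 by fin_cases k <;> simp) with rfl | rfl
    · exact h11'.symm
    · exact h22'.symm
  have he : ∀ i, VanGeemen1994.pullbackOne A φ (ofRatClassBaseChange (Motives.ComplexPoints A.X) 1
      (cb ((k, 0), i))) = μ k • ofRatClassBaseChange (Motives.ComplexPoints A.X) 1 (cb ((k, 0), i)) := fun i => by
    have h := congrArg (ofRatClassBaseChange (Motives.ComplexPoints A.X) 1)
      (Module.End.mem_eigenspace_iff.1 (hcbW k i))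
    rw [hφQ, ofRatClassBaseChange_baseChange_bettiMapHom, map_smul] at h
    exact h
  have hf : ∀ i, VanGeemen1994.pullbackOne A φ (ofRatClassBaseChange (Motives.ComplexPoints A.X) 1
      (cb ((k, 1), i))) = starRingEnd ℂ (μ k) • ofRatClassBaseChange (Motives.ComplexPoints A.X) 1
        (cb ((k, 1), i)) := fun i => by
    have h := congrArg (ofRatClassBaseChange (Motives.ComplexPoints A.X) 1)
      (Module.End.mem_eigenspace_iff.1 (hcbW' k i))
    rw [hφQ, ofRatClassBaseChange_baseChange_bettiMapHom, map_smul] at h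
    exact h
  exact Milne1999.sum_cross_mem_span_rational_oneOne_of_eigen φ (g j) (g j')
    (fun i => ofRatClassBaseChange (Motives.ComplexPoints A.X) 1 (cb ((k, 0), i)))
    (fun i => ofRatClassBaseChange (Motives.ComplexPoints A.X) 1 (cb ((k, 1), i))) hneμ he hf hθ

end Assembly

/-- **Moonen–Zarhin 1999 Thm. (0.2)(4), simple Type IV(2,1) of signature `{(1,1),(2,0)}`, all powers —
UNCONDITIONAL: `B•(A^{N+1}) = D•(A^{N+1}) ⊗ ℂ`** for a simple complex abelian fourfold `A` with
`finrank_ℚ End⁰(A) = 4` and `φ ∈ End(A)` acting on `H^{1,0}(A)` with eigenvalues `μ₁, conj μ₁` (multiplicity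
`1` each) and `μ₂` (multiplicity `2`), the four numbers `μ₁, conj μ₁, μ₂, conj μ₂` pairwise distinct.
[cite: MoonenZarhin1999LowDim, Thm. (0.2)(4) and §2 (2.4)] [cite: MoonenZarhin1995Duke, Thm. (0.2) for simple fourfolds (via MZ99 (2.4))] -/
theorem AbelianVariety.isDivisorGenerated_powSucc_of_quarticCM (A : AbelianVariety ℂ) (hA : A.IsSimple)
    (φ : A ⟶ A) (hE4 : Module.finrank ℚ A.endAlgebra = 4) {μ₁ μ₂ : ℂ} (h11 : starRingEnd ℂ μ₁ ≠ μ₁)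
    (h22 : starRingEnd ℂ μ₂ ≠ μ₂) (h12 : μ₂ ≠ μ₁) (h12' : μ₂ ≠ starRingEnd ℂ μ₁)
    (h1 : eigenMultiplicity A φ μ₁ = 1) (h1' : eigenMultiplicity A φ (starRingEnd ℂ μ₁) = 1)
    (h2 : eigenMultiplicity A φ μ₂ = 2) (hdim : A.dim = 4) (N : ℕ) : IsDivisorGenerated (A.powSucc N) :=
  (AVSlots.powSucc A N).isDivisorGenerated_of_quarticCM hA φ hE4 h11 h22 h12 h12' h1 h1' h2 hdim

/-- `A` itself: `B•(A) = D•(A) ⊗ ℂ` for a simple fourfold of quartic CM type `{(1,1),(2,0)}`.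
[cite: MoonenZarhin1999LowDim, Thm. (0.2)(4)] -/
theorem AbelianVariety.isDivisorGenerated_of_quarticCM (A : AbelianVariety ℂ) (hA : A.IsSimple)
    (φ : A ⟶ A) (hE4 : Module.finrank ℚ A.endAlgebra = 4) {μ₁ μ₂ : ℂ} (h11 : starRingEnd ℂ μ₁ ≠ μ₁)
    (h22 : starRingEnd ℂ μ₂ ≠ μ₂) (h12 : μ₂ ≠ μ₁) (h12' : μ₂ ≠ starRingEnd ℂ μ₁)
    (h1 : eigenMultiplicity A φ μ₁ = 1) (h1' : eigenMultiplicity A φ (starRingEnd ℂ μ₁) = 1)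
    (h2 : eigenMultiplicity A φ μ₂ = 2) (hdim : A.dim = 4) : IsDivisorGenerated A :=
  (avSlots_self A).isDivisorGenerated_of_quarticCM hA φ hE4 h11 h22 h12 h12' h1 h1' h2 hdim

/-- **The Hodge conjecture for all powers `A^{N+1}` of a simple complex abelian fourfold of quartic CM type with
signature `{(1,1),(2,0)}` — UNCONDITIONAL** (`B = D` above with Lefschetz `(1,1)`: the tree's
`hodgeConjectureFor_of_isDivisorGenerated`). MZ99 (0.2)(4): "`B(Xⁿ) = D(Xⁿ)` for all `n`"; (2.4): the simple
case is Moonen–Zarhin 1995. [cite: MoonenZarhin1999LowDim, Thm. (0.2)(4) and §2 (2.4)]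
[cite: MoonenZarhin1995Duke, Thm. (0.2) for simple fourfolds (via MZ99 (2.4))] -/
theorem hodgeConjectureFor_powSucc_of_quarticCM (A : AbelianVariety ℂ) (hA : A.IsSimple)
    (φ : A ⟶ A) (hE4 : Module.finrank ℚ A.endAlgebra = 4) {μ₁ μ₂ : ℂ} (h11 : starRingEnd ℂ μ₁ ≠ μ₁)
    (h22 : starRingEnd ℂ μ₂ ≠ μ₂) (h12 : μ₂ ≠ μ₁) (h12' : μ₂ ≠ starRingEnd ℂ μ₁)
    (h1 : eigenMultiplicity A φ μ₁ = 1) (h1' : eigenMultiplicity A φ (starRingEnd ℂ μ₁) = 1)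
    (h2 : eigenMultiplicity A φ μ₂ = 2) (hdim : A.dim = 4) (N : ℕ) :
    HodgeConjectureFor (A.powSucc N).dim (A.powSucc N).X :=
  hodgeConjectureFor_of_isDivisorGenerated _
    (AbelianVariety.isDivisorGenerated_powSucc_of_quarticCM A hA φ hE4 h11 h22 h12 h12' h1 h1' h2 hdim N)

/-- **The Hodge conjecture for `A` itself**, `A` a simple fourfold of quartic CM type `{(1,1),(2,0)}`.
[cite: MoonenZarhin1999LowDim, Thm. (0.2)(4)] -/
theorem hodgeConjectureFor_of_quarticCM (A : AbelianVariety ℂ) (hA : A.IsSimple)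
    (φ : A ⟶ A) (hE4 : Module.finrank ℚ A.endAlgebra = 4) {μ₁ μ₂ : ℂ} (h11 : starRingEnd ℂ μ₁ ≠ μ₁)
    (h22 : starRingEnd ℂ μ₂ ≠ μ₂) (h12 : μ₂ ≠ μ₁) (h12' : μ₂ ≠ starRingEnd ℂ μ₁)
    (h1 : eigenMultiplicity A φ μ₁ = 1) (h1' : eigenMultiplicity A φ (starRingEnd ℂ μ₁) = 1)
    (h2 : eigenMultiplicity A φ μ₂ = 2) (hdim : A.dim = 4) : HodgeConjectureFor A.dim A.X :=
  hodgeConjectureFor_of_isDivisorGenerated _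
    (AbelianVariety.isDivisorGenerated_of_quarticCM A hA φ hE4 h11 h22 h12 h12' h1 h1' h2 hdim)

/-- **The Hodge conjecture for every complex abelian variety isogenous to a power of a simple fourfold of quartic CM
type `{(1,1),(2,0)}`** (van Geemen Lemma 3.7 = the tree's `HodgeConjectureFor.of_isIsogenous`).
[cite: vanGeemen1994HodgeAV, Lemma 3.7] [cite: MoonenZarhin1999LowDim, Thm. (0.2)(4)] -/
theorem hodgeConjectureFor_of_isIsogenous_powSucc_of_quarticCM {A B' : AbelianVariety ℂ} (hA : A.IsSimple)
    (φ : A ⟶ A) (hE4 : Module.finrank ℚ A.endAlgebra = 4) {μ₁ μ₂ : ℂ} (h11 : starRingEnd ℂ μ₁ ≠ μ₁)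
    (h22 : starRingEnd ℂ μ₂ ≠ μ₂) (h12 : μ₂ ≠ μ₁) (h12' : μ₂ ≠ starRingEnd ℂ μ₁)
    (h1 : eigenMultiplicity A φ μ₁ = 1) (h1' : eigenMultiplicity A φ (starRingEnd ℂ μ₁) = 1)
    (h2 : eigenMultiplicity A φ μ₂ = 2) (hdim : A.dim = 4) {N : ℕ} (hB : B'.IsIsogenous (A.powSucc N)) :
    HodgeConjectureFor B'.dim B'.X :=
  HodgeConjectureFor.of_isIsogenous hB
    (hodgeConjectureFor_powSucc_of_quarticCM A hA φ hE4 h11 h22 h12 h12' h1 h1' h2 hdim N)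

end Literature.AlgebraicGeometry.HodgeTheory

end
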